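import Mathlib
import Summits.ResolutionOfSingularities.ResolutionOfSingularities.Theorems.CleanModels.Negative.CossartPiltant2019Thm15iFrameFalseOfCriticalWitness
import Summits.ResolutionOfSingularities.ResolutionOfSingularities.Theorems.CleanModels.Negative.CossartPiltant2019Thm15iFrameOrdWitness
import HarnessLib

/-!
# F-110 is FALSE modulo the three-ring shape of towers along `ord_𝔪` (res-inputs-crit-1 R190 (3))

Second negative lemma (INPUTS seat res-inputs-p-cp15frame g1, director KEY DR-IN5 (P)(ii), 2026-08-28) on the RETIRED statement
F-110 `Literature.AlgebraicGeometry.CossartPiltant200819.CossartPiltant2019_thm_1_5_i_frame` (crux `CleanModels`,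
stmt-ResolutionOfSingularities-15917): it SHRINKS the hypothesis of
`CossartPiltant2019_thm_1_5_i_frame_false_of_criticalWitness` (`CP15FrameCriticalWitness`, file
`CossartPiltant2019Thm15iFrameFalseOfCriticalWitness.lean`) to the honest residual of the divisorial witness, using the
witness base built in `CossartPiltant2019Thm15iFrameOrdWitness.lean` (`S = 𝔽_p[X₀,X₁,X₂]_{(X)}`, `K`, `f = X₀²X₁`,
`O = ord_𝔪`, all hypotheses of F-110 PROVED there).

PROVED here (0 sorry, no named fact):
* `OrdWitness.ordVK_line_ne_expNeg_one` — **the affine `K^p`-line through `x²y` has no element of order `1`** (`p ≥ 5`):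
  `ord (C^p f + D^p) = min (p·ord C + 3, p·ord D) ∉ {1}`; and `OrdWitness.ordVK_summands_of_line_le_one` — a line element in
  `O` has `ord (C^p f) > 0` and `D ∈ O`;
* `OrdWitness.mem_maximalIdeal_iff_valuation_lt_one` — a tower member is dominated by `O` (`𝔪 = {ord > 0}`);
* `ordFrameTowersCritical_of_ordTowerShape` — SHAPE ⟹ CRITICAL END (`p ≥ 5`);
* `cp15FrameCriticalWitness_of_ordFrameTowersCritical` — the divisorial data IS a critical witness once its towers end
  critically (all F-110 hypotheses discharged by the witness file; `p = 5`);
* `CossartPiltant2019_thm_1_5_i_frame_false_of_ordFrameTowersCritical`, and the headline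
  **`CossartPiltant2019_thm_1_5_i_frame_false_of_ordTowerShape : OrdTowerShape 5 → ¬ CossartPiltant2019_thm_1_5_i_frame.{0}`**.

THE RESIDUAL HYPOTHESIS `H″ = OrdTowerShape 5` (`--negative-modulo`; a classification item, NOT a published statement): along
`ord_𝔪` on `𝔽₅[x,y,w]_{(x,y,w)}`, the last member `B n` of every F-110 tower (local blowing ups along regular centres, binders
verbatim) has (a) all its regular parameters of order EXACTLY `1` and (b) residue field relatively `5`-closed in `κ(O)`.
res-inputs-crit-1 R190 (3), on paper: every member is `S` itself, a `B♯ = S[v/u₀]_{𝔪_S S[v/u₀]}` (centre a regular curve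
`(u₀, v)`; 2-dimensional, `κ = 𝔽₅(τ)` algebraically closed in `κ(O) = 𝔽₅(τ,σ)`, parameters `αL₁ + βL₃` of order `1`) or `O`
(centre the closed point: the local blowing up IS the DVR `ord_𝔪`); height-one centres are principal (trivial step).  Typing that
classification of `IsLocalBlowupAlong` steps is the remaining work for an UNCONDITIONAL `¬ F-110`; no Abhyankar, no named fact.

HONESTY: nothing here proves or refutes resolution of singularities in characteristic `p`, `CleanModels`, or rung B; the printed
Cossart–Piltant Thm 1.5 is fine (`CossartPiltant2019Local`); only the typed frame shape is refuted, modulo `H″`.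
[OURS · NEGATIVE] counted 0.
-/

noncomputable section

set_option linter.dupNamespace false -- mandated namespace of this single-conjunct summit

open MvPolynomial IsLocalRing
open Literature.AlgebraicGeometry.Resolution Literature.AlgebraicGeometry.Resolution.WeightedBlowup

namespace Summit.ResolutionOfSingularities.ResolutionOfSingularities.Theorems.CleanModels.Negative

namespace OrdWitness

variable (p : ℕ) [hp : Fact p.Prime]

/-! ## 4. Order bookkeeping on the affine `K^p`-line through `f` -/

/-- `ord (C^p · x²y) ∉ {0, 1}` for `p ≥ 5`: `p·ord C + 3` is neither `0` nor `1`. [folklore] -/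
theorem ordVK_pow_mul_f_ne (hp5 : 5 ≤ p) (C : K p) {m : ℕ} (hm : m = 0 ∨ m = 1) :
    ordVK p (C ^ p * algebraMap (S p) (K p) (f p)) ≠ expNeg m := by
  have hpr : p.Prime := hp.out
  intro h
  rw [map_mul, map_pow, ordVK_f] at h
  rcases eq_or_ne (ordVK p C) 0 with h0 | h0
  · rw [h0, zero_pow hpr.ne_zero, zero_mul] at h
    exact (expNeg_ne_zero m) h.symm
  · obtain ⟨z, hz⟩ := WithZero.ne_zero_iff_exists.mp h0
    rw [← hz, expNeg, expNeg, ← WithZero.coe_pow, ← WithZero.coe_mul, WithZero.coe_inj] at h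
    have h2 := congr_arg Multiplicative.toAdd h
    rw [toAdd_mul, toAdd_pow, toAdd_ofAdd, toAdd_ofAdd, nsmul_eq_mul] at h2
    have h2' : (p : ℤ) * Multiplicative.toAdd z = 3 - m := by
      have : (p : ℤ) * Multiplicative.toAdd z + -3 = -m := by simpa using h2
      linarith
    rcases hm with rfl | rfl
    · have h3 : (p : ℤ) ∣ 3 := ⟨Multiplicative.toAdd z, by rw [h2']; norm_num⟩
      have h4 : p ∣ 3 := by exact_mod_cast h3
      have := Nat.le_of_dvd (by norm_num) h4
      omega
    · have h3 : (p : ℤ) ∣ 2 := ⟨Multiplicative.toAdd z, by rw [h2']; norm_num⟩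
      have h4 : p ∣ 2 := by exact_mod_cast h3
      have := Nat.le_of_dvd two_pos h4
      omega

/-- `ord (D^p) ≠ 1`. [folklore] -/
theorem ordVK_pow_ne_expNeg_one (D : K p) : ordVK p (D ^ p) ≠ expNeg 1 := by
  have hpr : p.Prime := hp.out
  intro h
  rw [map_pow] at h
  rcases eq_or_ne (ordVK p D) 0 with h0 | h0
  · rw [h0, zero_pow hpr.ne_zero] at h
    exact (expNeg_ne_zero 1) h.symm
  · obtain ⟨z, hz⟩ := WithZero.ne_zero_iff_exists.mp h0
    rw [← hz, expNeg, ← WithZero.coe_pow, WithZero.coe_inj] at h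
    have h2 := congr_arg Multiplicative.toAdd h
    rw [toAdd_pow, toAdd_ofAdd, nsmul_eq_mul] at h2
    have h2' : (p : ℤ) * Multiplicative.toAdd z = -1 := by simpa using h2
    have h3 : (p : ℤ) ∣ 1 := ⟨-(Multiplicative.toAdd z), by rw [mul_neg, h2']; norm_num⟩
    have h4 : p ∣ 1 := by exact_mod_cast h3
    exact hpr.one_lt.ne' (Nat.dvd_one.mp h4)

/-- The two summands `C^p · x²y` and `D^p` never have the same nonzero value (`3 ∉ pℤ` for `p ≥ 5`). [folklore] -/
theorem ordVK_pow_eq_zero_of_eq (hp5 : 5 ≤ p) (C D : K p)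
    (h : ordVK p (C ^ p * algebraMap (S p) (K p) (f p)) = ordVK p (D ^ p)) : ordVK p (D ^ p) = 0 := by
  have hpr : p.Prime := hp.out
  by_contra hD0
  rw [map_mul, map_pow, ordVK_f, map_pow] at h
  have hD : ordVK p D ≠ 0 := fun e => hD0 (by rw [map_pow, e, zero_pow hpr.ne_zero])
  have hC : ordVK p C ≠ 0 := by
    intro e
    rw [e, zero_pow hpr.ne_zero, zero_mul] at h
    exact hD0 (by rw [map_pow]; exact h.symm)
  obtain ⟨z, hz⟩ := WithZero.ne_zero_iff_exists.mp hC
  obtain ⟨y, hy⟩ := WithZero.ne_zero_iff_exists.mp hD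
  rw [← hz, ← hy, expNeg, ← WithZero.coe_pow, ← WithZero.coe_pow, ← WithZero.coe_mul, WithZero.coe_inj] at h
  have h2 := congr_arg Multiplicative.toAdd h
  rw [toAdd_mul, toAdd_pow, toAdd_pow, toAdd_ofAdd, nsmul_eq_mul, nsmul_eq_mul] at h2
  have h2' : (p : ℤ) * Multiplicative.toAdd z + -3 = (p : ℤ) * Multiplicative.toAdd y := by simpa using h2
  have h3 : (p : ℤ) ∣ 3 := ⟨Multiplicative.toAdd z - Multiplicative.toAdd y, by rw [mul_sub]; linarith⟩
  have h4 : p ∣ 3 := by exact_mod_cast h3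
  have := Nat.le_of_dvd (by norm_num) h4
  omega

/-- **The affine `K^p`-line through `x²y` avoids order `1`** (res-inputs-crit-1 R190 (3)): for `p ≥ 5` and all `C, D ∈ K`,
`ord (C^p · f + D^p) = min (p·ord C + 3, p·ord D) ≠ 1`, i.e. `ordVK (C^p f + D^p) ≠ exp (−1)`. [folklore] -/
theorem ordVK_line_ne_expNeg_one (hp5 : 5 ≤ p) (C D : K p) :
    ordVK p (C ^ p * algebraMap (S p) (K p) (f p) + D ^ p) ≠ expNeg 1 := by
  intro h
  rcases eq_or_ne (ordVK p (C ^ p * algebraMap (S p) (K p) (f p))) (ordVK p (D ^ p)) with heq | hneq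
  · have hD := ordVK_pow_eq_zero_of_eq p hp5 C D heq
    have hC : ordVK p (C ^ p * algebraMap (S p) (K p) (f p)) = 0 := by rw [heq, hD]
    have : ordVK p (C ^ p * algebraMap (S p) (K p) (f p) + D ^ p) = 0 := by
      apply le_antisymm _ zero_le
      calc ordVK p (C ^ p * algebraMap (S p) (K p) (f p) + D ^ p)
          ≤ max (ordVK p (C ^ p * algebraMap (S p) (K p) (f p))) (ordVK p (D ^ p)) := Valuation.map_add _ _ _
        _ = 0 := by rw [hC, hD, max_self]
    rw [this] at h
    exact (expNeg_ne_zero 1) h.symm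
  · rw [Valuation.map_add_of_distinct_val _ hneq] at h
    rcases le_total (ordVK p (C ^ p * algebraMap (S p) (K p) (f p))) (ordVK p (D ^ p)) with hle | hle
    · rw [max_eq_right hle] at h; exact ordVK_pow_ne_expNeg_one p D h
    · rw [max_eq_left hle] at h; exact ordVK_pow_mul_f_ne p hp5 C (Or.inr rfl) h

/-- **A line element inside `O` has its `f`-summand of positive order and `D ∈ O`**: if `ord (C^p f + D^p) ≥ 0` then
`ord (C^p f) > 0` and `ord D ≥ 0` (the summands have distinct values, so the value of the sum is their maximum).
[folklore] -/
theorem ordVK_summands_of_line_le_one (hp5 : 5 ≤ p) (C D : K p)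
    (h : ordVK p (C ^ p * algebraMap (S p) (K p) (f p) + D ^ p) ≤ 1) :
    ordVK p (C ^ p * algebraMap (S p) (K p) (f p)) < 1 ∧ D ∈ O p := by
  have hpr : p.Prime := hp.out
  have hboth : ordVK p (C ^ p * algebraMap (S p) (K p) (f p)) ≤ 1 ∧ ordVK p (D ^ p) ≤ 1 := by
    rcases eq_or_ne (ordVK p (C ^ p * algebraMap (S p) (K p) (f p))) (ordVK p (D ^ p)) with heq | hneq
    · have hD := ordVK_pow_eq_zero_of_eq p hp5 C D heq
      rw [heq, hD]
      exact ⟨zero_le, zero_le⟩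
    · rw [Valuation.map_add_of_distinct_val _ hneq, max_le_iff] at h
      exact h
  refine ⟨lt_of_le_of_ne hboth.1 ?_, ?_⟩
  · rw [← expNeg_zero]
    exact ordVK_pow_mul_f_ne p hp5 C (Or.inl rfl)
  · rw [mem_O_iff]
    by_contra hD
    have h1 : 1 < ordVK p D ^ p := one_lt_pow₀ (not_le.mp hD) hpr.ne_zero
    rw [← map_pow] at h1
    exact not_le.mpr h1 hboth.2

/-! ## 5. Domination of tower members -/

omit hp in
/-- In a subring `X ⊆ O` that is its own localisation at the centre of `O` (every member of a tower of local blowing ups is),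
the maximal ideal consists of the elements of `O`-value `< 1`. [folklore] -/
theorem mem_maximalIdeal_iff_valuation_lt_one {L : Type} [Field L] {W : ValuationSubring L} {X : Subring L}
    (hXW : X ≤ W.toSubring) (hfix : locAtCentre X W = X) [IsLocalRing X] (x : X) :
    x ∈ maximalIdeal X ↔ W.valuation (x : L) < 1 := by
  have hle : W.valuation (x : L) ≤ 1 := (W.valuation_le_one_iff _).mpr (hXW x.2)
  constructor
  · intro hx
    by_contra hlt
    have heq : W.valuation (x : L) = 1 := le_antisymm hle (not_lt.mp hlt)
    have hinv : (x : L)⁻¹ ∈ X := by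
      have h0 := inv_mem_locAtCentre (le_locAtCentre X W x.2) heq
      rw [hfix] at h0
      exact h0
    have hunit : IsUnit x :=
      ⟨⟨x, ⟨(x : L)⁻¹, hinv⟩, Subtype.ext (mul_inv_cancel₀ (ne_zero_of_valuation_eq_one heq)),
        Subtype.ext (inv_mul_cancel₀ (ne_zero_of_valuation_eq_one heq))⟩, rfl⟩
    exact (IsLocalRing.mem_maximalIdeal _ |>.mp hx) hunit
  · intro hlt
    rw [IsLocalRing.mem_maximalIdeal, mem_nonunits_iff]
    rintro ⟨u, rfl⟩
    have h1 : W.valuation ((u : X) : L) * W.valuation ((↑u⁻¹ : X) : L) = 1 := by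
      rw [← map_mul, ← Subring.coe_mul, Units.mul_inv, Subring.coe_one, map_one]
    have h2 : W.valuation ((↑u⁻¹ : X) : L) ≤ 1 := (W.valuation_le_one_iff _).mpr (hXW (↑u⁻¹ : X).2)
    have : W.valuation ((u : X) : L) * W.valuation ((↑u⁻¹ : X) : L) < 1 * 1 :=
      mul_lt_mul_of_lt_of_le_of_nonneg_of_pos hlt h2 zero_le zero_lt_one
    rw [h1, one_mul] at this
    exact lt_irrefl _ this

/-- `O.valuation x < 1 ⟺ ordVK x < 1` (the two valuations are equivalent). [folklore] -/
theorem valuation_O_lt_one_iff (x : K p) : (O p).valuation x < 1 ↔ ordVK p x < 1 :=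
  ((Valuation.isEquiv_valuation_valuationSubring (ordVK p)).lt_one_iff_lt_one).symm

end OrdWitness


/-! ## 6. The reduced hypotheses: towers along `ord_𝔪` end critically / have the three-ring shape -/

/-- **`H′ = OrdFrameTowersCritical p`** (hypothesis of the companion negative lemma; a CONSTRUCTION/CLASSIFICATION item, NOT a
published statement): along the divisorial witness (`S = 𝔽_p[X₀,X₁,X₂]_{(X)}`, `K`, `f = X₀²X₁`, `O = ord_𝔪`, all built above),
every tower that F-110 quantifies over — binders verbatim — ends CRITICALLY: `g n − e^p ∈ 𝔪_{B n}²` for some `e ∈ B n`.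
On paper (res-inputs-crit-1 R190 (3), for `p = 5`): every tower member is `S`, a `B♯ = S[v/u₀]_{𝔪_S S[v/u₀]}` (regular curve
centre) or `O` itself, all regular parameters of these have order `1`, their residue fields are relatively 5-closed in `κ(O)`,
and the affine line through `x²y` has no element of order `1` (`OrdWitness.ordVK_line_ne_expNeg_one`). -/
def OrdFrameTowersCritical (p : ℕ) [Fact p.Prime] : Prop :=
  ∀ (n : ℕ) (B : ℕ → Subring (OrdWitness.K p)) (g : ℕ → OrdWitness.K p),
    B 0 = locAtCentre (algebraMap (OrdWitness.S p) (OrdWitness.K p)).range (OrdWitness.O p) →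
    g 0 = algebraMap (OrdWitness.S p) (OrdWitness.K p) (OrdWitness.f p) →
    (∀ i ≤ n, B i ≤ (OrdWitness.O p).toSubring ∧ IsRegularLocalRing (B i) ∧ g i ∈ B i) →
    (∀ i < n, ∃ P : Ideal (B i), IsRegularLocalRing ((B i) ⧸ P) ∧
      IsLocalBlowupAlong (OrdWitness.O p) (B i) P (B (i + 1)) ∧
      ∃ c d : OrdWitness.K p, c ≠ 0 ∧ g (i + 1) = c ^ p * g i + d ^ p) →
    ∀ (_ : IsRegularLocalRing (B n)) (hg : g n ∈ B n),
      ∃ e : B n, (⟨g n, hg⟩ : B n) - e ^ p ∈ IsLocalRing.maximalIdeal (B n) ^ 2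

/-- **`H″ = OrdTowerShape p`** (the honest residual: res-inputs-crit-1 R190 (3)'s THREE-RING CLASSIFICATION, stated through its
two consequences that matter; a classification item, NOT a published statement).  Along the divisorial witness, the last member
`B n` of every tower of local blowing ups along regular centres that F-110 quantifies over (binders verbatim, the irrelevant
radicand bookkeeping dropped) satisfies: (a) every regular parameter — element of `𝔪 ∖ 𝔪²` — has `ord_𝔪`-value EXACTLY `1`
(`exp (−1)`); (b) a unit of `B n` whose residue is a `p`-th power in `κ(O)` has a residue that is a `p`-th power in `κ(B n)`
(`κ(B n)` relatively `p`-closed in `κ(O)`).  On paper: the members are `S` (order valuation, `κ = 𝔽_p`), the rings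
`B♯ = S[v/u₀]_{𝔪_S S[v/u₀]}` (`κ = 𝔽_p(τ)` algebraically closed in `κ(O) = 𝔽_p(τ, σ)`, parameters `αL₁ + βL₃` of order `1`)
and `O` itself. -/
def OrdTowerShape (p : ℕ) [Fact p.Prime] : Prop :=
  ∀ (n : ℕ) (B : ℕ → Subring (OrdWitness.K p)),
    B 0 = locAtCentre (algebraMap (OrdWitness.S p) (OrdWitness.K p)).range (OrdWitness.O p) →
    (∀ i ≤ n, B i ≤ (OrdWitness.O p).toSubring ∧ IsRegularLocalRing (B i)) →
    (∀ i < n, ∃ P : Ideal (B i), IsRegularLocalRing ((B i) ⧸ P) ∧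
      IsLocalBlowupAlong (OrdWitness.O p) (B i) P (B (i + 1))) →
    ∀ (_ : IsRegularLocalRing (B n)),
      (∀ t : B n, t ∈ IsLocalRing.maximalIdeal (B n) → t ∉ IsLocalRing.maximalIdeal (B n) ^ 2 →
        OrdWitness.ordVK p (t : OrdWitness.K p) = OrdWitness.expNeg 1) ∧
      (∀ (u : B n) (d : OrdWitness.K p), d ∈ OrdWitness.O p →
        OrdWitness.ordVK p ((u : OrdWitness.K p) - d ^ p) < 1 →
        ∃ e : B n, OrdWitness.ordVK p ((u : OrdWitness.K p) - (e : OrdWitness.K p) ^ p) < 1)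

/-- **Shape ⟹ critical end** (the Lean half of R190 (3)): for `p ≥ 5`, `OrdTowerShape p → OrdFrameTowersCritical p`.  Compose
the line moves to `g n = C^p f + D^p`; `g n ∈ B n ⊆ O` forces `ord (C^p f) > 0` and `D ∈ O`; the last member is dominated by
`O` (it is its own localisation at the centre), so `𝔪_{B n} = {ord > 0}`; if `g n ∈ 𝔪` it lies in `𝔪²` (a parameter would have
order `1`, a line element never has); if `g n` is a unit, (b) gives `e ∈ B n` with `g n − e^p ∈ 𝔪`, again a line element
(`(D − e)^p`), hence in `𝔪²`. [folklore] -/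
theorem ordFrameTowersCritical_of_ordTowerShape (p : ℕ) [hp : Fact p.Prime] (hp5 : 5 ≤ p)
    (H : OrdTowerShape p) : OrdFrameTowersCritical p := by
  intro n B g hB0 hg0 hB hstep hregn hgn
  have hpr : p.Prime := hp.out
  haveI : CharP (OrdWitness.K p) p := OrdWitness.charP_K p
  obtain ⟨hshape_a, hshape_b⟩ := H n B hB0 (fun i hi => ⟨(hB i hi).1, (hB i hi).2.1⟩)
    (fun i hi => by
      obtain ⟨P, h1, h2, -⟩ := hstep i hi
      exact ⟨P, h1, h2⟩) hregn
  -- Step 1: the line moves compose: `g n = C^p f + D^p`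
  have hline : ∀ i ≤ n, ∃ C D : OrdWitness.K p,
      g i = C ^ p * algebraMap (OrdWitness.S p) (OrdWitness.K p) (OrdWitness.f p) + D ^ p := by
    intro i hi
    induction i with
    | zero => exact ⟨1, 0, by rw [hg0, one_pow, one_mul, zero_pow hpr.ne_zero, add_zero]⟩
    | succ j ih =>
      obtain ⟨C, D, hj⟩ := ih (by omega)
      obtain ⟨P, -, -, c, d, -, hstepj⟩ := hstep j (by omega)
      refine ⟨c * C, c * D + d, ?_⟩
      rw [hstepj, hj, add_pow_char, mul_pow, mul_pow]
      ring
  obtain ⟨C, D, hgCD⟩ := hline n le_rfl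
  -- Step 2: the last member is dominated by `O`
  have hBnO : B n ≤ (OrdWitness.O p).toSubring := (hB n le_rfl).1
  have hfix : locAtCentre (B n) (OrdWitness.O p) = B n := by
    rcases n with _ | j
    · rw [hB0]; exact locAtCentre_locAtCentre _ _
    · obtain ⟨P, -, hblow, -⟩ := hstep j (by omega)
      exact hblow.isLocalBlowup.locAtCentre_eq
  have hdom : ∀ x : B n, x ∈ IsLocalRing.maximalIdeal (B n) ↔ OrdWitness.ordVK p (x : OrdWitness.K p) < 1 := by
    intro x
    rw [OrdWitness.mem_maximalIdeal_iff_valuation_lt_one hBnO hfix x, OrdWitness.valuation_O_lt_one_iff]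
  -- Step 3: values of the summands
  have hgO : OrdWitness.ordVK p (g n) ≤ 1 := (OrdWitness.mem_O_iff p (g n)).mp (hBnO hgn)
  have hsum := OrdWitness.ordVK_summands_of_line_le_one p hp5 C D (by rw [← hgCD]; exact hgO)
  -- Step 4: the two cases
  rcases hgO.lt_or_eq with hlt | heq1
  · -- `g n ∈ 𝔪`: then `g n ∈ 𝔪²`, with `e = 0`
    refine ⟨0, ?_⟩
    rw [zero_pow hpr.ne_zero, sub_zero]
    by_contra hnot
    have hmem : (⟨g n, hgn⟩ : B n) ∈ IsLocalRing.maximalIdeal (B n) := (hdom _).mpr hlt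
    have h1 := hshape_a ⟨g n, hgn⟩ hmem hnot
    exact OrdWitness.ordVK_line_ne_expNeg_one p hp5 C D (by rw [← hgCD]; exact h1)
  · -- `g n` a unit: translate by `e^p` with `ḡ = ē^p`
    have h1 : OrdWitness.ordVK p (g n - D ^ p) < 1 := by
      rw [hgCD, add_sub_cancel_right]; exact hsum.1
    obtain ⟨e, he⟩ := hshape_b ⟨g n, hgn⟩ D hsum.2 h1
    refine ⟨e, ?_⟩
    by_contra hnot
    have hmem : (⟨g n, hgn⟩ - e ^ p : B n) ∈ IsLocalRing.maximalIdeal (B n) := by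
      rw [hdom]
      simpa using he
    have h2 := hshape_a _ hmem hnot
    have hline' : ((⟨g n, hgn⟩ - e ^ p : B n) : OrdWitness.K p) =
        C ^ p * algebraMap (OrdWitness.S p) (OrdWitness.K p) (OrdWitness.f p) + (D - (e : OrdWitness.K p)) ^ p := by
      push_cast
      rw [hgCD, sub_pow_char]
      ring
    rw [hline'] at h2
    exact OrdWitness.ordVK_line_ne_expNeg_one p hp5 C (D - (e : OrdWitness.K p)) h2

/-! ## 7. The negative lemmas modulo `H′` / `H″` -/

/-- **The divisorial data is a critical witness once its towers end critically** (`p = 5`): every hypothesis of F-110 is a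
theorem of the witness file (`S` regular local, excellent, `dim 3`, `char 5`; `K = Frac S`; `x²y ∉ K⁵`; `S ≤ O` dominating).
[folklore] -/
theorem cp15FrameCriticalWitness_of_ordFrameTowersCritical
    (h : @OrdFrameTowersCritical 5 ⟨Nat.prime_five⟩) : CP15FrameCriticalWitness := by
  haveI : Fact (Nat.Prime 5) := ⟨Nat.prime_five⟩
  exact ⟨5, Nat.prime_five, OrdWitness.S 5, inferInstance, OrdWitness.isRegularLocalRing_S 5,
    OrdWitness.isExcellentRing_S 5, OrdWitness.ringKrullDim_S 5, OrdWitness.charP_S 5,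
    OrdWitness.K 5, inferInstance, inferInstance, inferInstance, OrdWitness.f 5,
    OrdWitness.f_not_pow 5 (by norm_num), OrdWitness.O 5, OrdWitness.range_le_O 5, OrdWitness.dominates 5, h⟩

/-- **F-110 is false modulo `H′`** (critical ends along `ord_𝔪`, `p = 5`). [folklore] -/
theorem CossartPiltant2019_thm_1_5_i_frame_false_of_ordFrameTowersCritical
    (h : @OrdFrameTowersCritical 5 ⟨Nat.prime_five⟩) :
    ¬ Literature.AlgebraicGeometry.CossartPiltant200819.CossartPiltant2019_thm_1_5_i_frame.{0} :=
  CossartPiltant2019_thm_1_5_i_frame_false_of_criticalWitness (cp15FrameCriticalWitness_of_ordFrameTowersCritical h)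

/-- **F-110 is false modulo `H″ = OrdTowerShape 5`** — the three-ring shape of towers along `ord_𝔪` on `𝔽₅[x,y,w]_{(x,y,w)}`
(res-inputs-crit-1 R190 (3)): regular parameters of the last tower member have order `1`, and its residue field is relatively
`5`-closed in `κ(O)`.  Everything else — the witness base, the order bookkeeping of the `K⁵`-line through `x²y`, the domination
of tower members, the regularity criterion for `B[X]/(X⁵ − g)` — is kernel-checked. [folklore] -/
theorem CossartPiltant2019_thm_1_5_i_frame_false_of_ordTowerShape (h : @OrdTowerShape 5 ⟨Nat.prime_five⟩) :
    ¬ Literature.AlgebraicGeometry.CossartPiltant200819.CossartPiltant2019_thm_1_5_i_frame.{0} :=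
  CossartPiltant2019_thm_1_5_i_frame_false_of_ordFrameTowersCritical
    (@ordFrameTowersCritical_of_ordTowerShape 5 ⟨Nat.prime_five⟩ (le_refl 5) h)

end Summit.ResolutionOfSingularities.ResolutionOfSingularities.Theorems.CleanModels.Negative

end
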